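import Summits.CriticalPhenomena.PercolationContinuityZ3.Theorems.PercNearOneGluingNoHeavyLowerTailNineTypeAllH
import Summits.CriticalPhenomena.PercolationContinuityZ3.Theorems.PercNearOneGluingNoHeavyLowerTailTwoCopyMonotoneBridge

/-!
# Nine-type kernels are good: from the abstract all-H theorems to `GoodKernel`

Support file for crux `stmt-CriticalPhenomena-4575` (master-family programme, quadratic four-point row `Q44b`),
seat `prim-l12-p6` gen 10.  Pure finite combinatorics + table facts by `decide`; no named facts, no sorries.

For a set `S ⊆ {1,…,9}` of `Q44b` bad types, the cell kernel `kerS S i j = [i ∈ AC ∧ j = ⊥] − [(i,j) is a bad pair of a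
type in S]` (cells indexed as in `FourPointAtoms.pat4`) is a `TwoCopyMono.GoodKernel` whenever `S` does not contain both a
type in `{5,7}` and a type in `{8,9}` (`goodKernel_kerS`).  Proof: a monotone equivalence-valued profile map `P` on the
subsets of a finite type takes values among the 15 partition profiles (`exists_pat_of_isEqv`); its bad points (type read off
`(P T, P Tᶜ)`) form a CONT-configuration whose goods `{T : P T ∈ AC, P Tᶜ = ⊥}` are an up-set containing the HL-forced unions
(table facts `cont_table`, `hl_table_join`, `hl_table_meet` over the 15 profiles), so `NineType.allH_card_le` gives
`#bad ≤ #good`, which is the antipodal count `Σ_T liftK (kerS S) (P T) (P Tᶜ) ≥ 0`.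
With the bridge `TwoCopyMono.sum_kernel_cell_nonneg` this yields the law-level packings of `…Q44bPackingsAllN`.
-/

namespace Summit.CriticalPhenomena.PercolationContinuityZ3.Theorems

namespace TwoCopyMono

open Finset FourPointAtoms

/-! ## The 15 partition profiles: classification of equivalence profiles -/

/-- Profile of the `i`-th four-point cell. [this work] -/
abbrev pp (i : Fin 15) : Prof := profOf (pat4 i)

/-- The six unordered pairs of `Fin 4`. [this work] -/
def pr6 : Fin 6 → Fin 4 × Fin 4 := ![(0,1), (0,2), (0,3), (1,2), (1,3), (2,3)]

/-- Index of the unordered pair `{i,j}` (`i ≠ j`), any value on the diagonal. [this work] -/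
def pidx (i j : Fin 4) : Fin 6 :=
  if (i = 0 ∧ j = 1) ∨ (i = 1 ∧ j = 0) then 0 else if (i = 0 ∧ j = 2) ∨ (i = 2 ∧ j = 0) then 1 else
  if (i = 0 ∧ j = 3) ∨ (i = 3 ∧ j = 0) then 2 else if (i = 1 ∧ j = 2) ∨ (i = 2 ∧ j = 1) then 3 else
  if (i = 1 ∧ j = 3) ∨ (i = 3 ∧ j = 1) then 4 else 5

/-- The symmetric reflexive profile with the given six off-diagonal bits. [this work] -/
def ofBits (f : Fin 6 → Bool) : Prof := fun i j => if i = j then true else f (pidx i j)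

/-- An equivalence profile is determined by its six upper bits. [this work] -/
theorem eq_ofBits {u : Prof} (h : IsEqv u) : u = ofBits (fun k => u (pr6 k).1 (pr6 k).2) := by
  funext i j
  have hr := h.refl; have hs := h.symm
  fin_cases i <;> fin_cases j <;> simp [ofBits, pidx, pr6, hr]
  all_goals first
    | rfl
    | (apply Bool.eq_iff_iff.2; constructor <;> intro hh <;> exact hs _ _ hh)

/-- Transitivity test of a six-bit profile. [this work] -/
def transOK (f : Fin 6 → Bool) : Bool :=
  decide (∀ i j k : Fin 4, ofBits f i j = true → ofBits f j k = true → ofBits f i k = true)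

/-- Table fact: the transitive six-bit profiles are exactly the 15 partition profiles. [this work] -/
theorem ofBits_classify : ∀ f : Fin 6 → Bool, transOK f = true → ∃ i : Fin 15, ofBits f = pp i := by
  decide

/-- **Classification**: an equivalence profile is one of the 15 partition profiles. [this work] -/
theorem exists_pat_of_isEqv {u : Prof} (h : IsEqv u) : ∃ i : Fin 15, u = pp i := by
  have hu := eq_ofBits h
  set f : Fin 6 → Bool := fun k => u (pr6 k).1 (pr6 k).2 with hf
  have ht : transOK f = true := by
    unfold transOK
    rw [decide_eq_true_iff]
    intro i j k h1 h2
    rw [← hu] at h1 h2 ⊢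
    exact h.trans i j k h1 h2
  obtain ⟨i, hi⟩ := ofBits_classify f ht
  exact ⟨i, hu.trans hi⟩

/-- The 15 partition profiles are pairwise distinct (table fact). [this work] -/
theorem pp_injective : ∀ i j : Fin 15, pp i = pp j → i = j := by decide

/-- `liftK` on partition profiles is the kernel entry. [this work] -/
theorem liftK_pp (κ : Fin 15 → Fin 15 → ℤ) (i j : Fin 15) : liftK κ (pp i) (pp j) = κ i j := by
  unfold liftK
  rw [Finset.sum_eq_single i, Finset.sum_eq_single j]
  · simp [pp]
  · intro j' _ hj'
    rw [if_neg]
    rintro ⟨_, h2⟩; exact hj' (pp_injective j j' h2).symm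
  · intro h; exact absurd (Finset.mem_univ j) h
  · intro i' _ hi'
    refine Finset.sum_eq_zero fun j' _ => ?_
    rw [if_neg]
    rintro ⟨h1, _⟩; exact hi' (pp_injective i i' h1).symm
  · intro h; exact absurd (Finset.mem_univ i) h

/-! ## Types, the kernel, and the table facts -/

/-- Profile order as a Boolean on cell indices. [this work] -/
def ple (i j : Fin 15) : Bool := decide (∀ a b : Fin 4, pp i a b = true → pp j a b = true)

/-- From the profile order to the Boolean table order. [this work] -/
theorem ple_of_profLE {i j : Fin 15} (h : ProfLE (pp i) (pp j)) : ple i j = true := by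
  unfold ple; rw [decide_eq_true_iff]; exact h.le

/-- Heavy cell of type `θ` (`1,2 ↦ ab|cy`; `3..7 ↦ ab|c|y`; `8,9 ↦ a|bcy`), as a `pat4` index. [this work] -/
def hIdx (θ : ℕ) : Fin 15 := if θ = 1 ∨ θ = 2 then 11 else if θ = 8 ∨ θ = 9 then 7 else 6

/-- Light cell of type `θ`, as a `pat4` index: `1↦ac|by, 2↦ay|bc, 3↦ac|by, 4↦ay|bc, 5↦a|b|cy, 6↦acy|b, 7↦a|bcy,
8↦ac|b|y, 9↦ay|b|c`. [this work] -/
def lIdx (θ : ℕ) : Fin 15 :=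
  if θ = 1 then 9 else if θ = 2 then 8 else if θ = 3 then 9 else if θ = 4 then 8 else if θ = 5 then 1 else
  if θ = 6 then 10 else if θ = 7 then 7 else if θ = 8 then 5 else 4

/-- `(i, j)` is the (heavy, light) pair of some type in `S`. [this work] -/
def badS (S : Finset ℕ) (i j : Fin 15) : Prop := ∃ θ ∈ S, hIdx θ = i ∧ lIdx θ = j

/-- `badS` is decidable. [this work] -/
instance (S : Finset ℕ) (i j : Fin 15) : Decidable (badS S i j) := by unfold badS; infer_instance

/-- The AC cells `ab|cy`, `abcy`. [this work] -/
def isAC (i : Fin 15) : Prop := i = 11 ∨ i = 14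

/-- `isAC` is decidable. [this work] -/
instance (i : Fin 15) : Decidable (isAC i) := by unfold isAC; infer_instance

/-- **The nine-type kernel of the type set `S`**: `[i ∈ AC ∧ j = ⊥] − [(i,j) bad of a type in S]`. [this work] -/
def kerS (S : Finset ℕ) (i j : Fin 15) : ℤ :=
  (if isAC i ∧ j = 0 then 1 else 0) - (if badS S i j then 1 else 0)

/-- Table fact (CONT): heavy cells increase and light cells decrease along a containment only for `contPairs`. [this work] -/
theorem cont_table : ∀ θ ∈ (Finset.Icc 1 9 : Finset ℕ), ∀ θ' ∈ (Finset.Icc 1 9 : Finset ℕ),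
    ple (hIdx θ) (hIdx θ') = true → ple (lIdx θ') (lIdx θ) = true → (θ, θ') ∈ NineType.contPairs := by
  decide

/-- Table fact (HL, join side): for `hlOK θ θ'`, every profile above the heavy cell of `θ` and the light cell of `θ'`
is an AC cell. [this work] -/
theorem hl_table_join : ∀ θ ∈ (Finset.Icc 1 9 : Finset ℕ), ∀ θ' ∈ (Finset.Icc 1 9 : Finset ℕ),
    NineType.hlOK θ θ' = true → ∀ x : Fin 15, ple (hIdx θ) x = true → ple (lIdx θ') x = true → isAC x := by
  decide

/-- Table fact (HL, meet side): for `hlOK θ θ'`, every profile below the light cell of `θ` and the heavy cell of `θ'`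
is `⊥`. [this work] -/
theorem hl_table_meet : ∀ θ ∈ (Finset.Icc 1 9 : Finset ℕ), ∀ θ' ∈ (Finset.Icc 1 9 : Finset ℕ),
    NineType.hlOK θ θ' = true → ∀ z : Fin 15, ple z (lIdx θ) = true → ple z (hIdx θ') = true → z = 0 := by
  decide

/-- Table fact: the AC cells form an up-set among the 15 profiles, and only `⊥` lies below `⊥`. [this work] -/
theorem ac_up_bot_down : (∀ x y : Fin 15, isAC x → ple x y = true → isAC y) ∧ (∀ z : Fin 15, ple z 0 = true → z = 0) := by
  decide

/-- Table fact: a bad pair determines its type. [this work] -/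
theorem type_unique : ∀ θ ∈ (Finset.Icc 1 9 : Finset ℕ), ∀ θ' ∈ (Finset.Icc 1 9 : Finset ℕ),
    hIdx θ = hIdx θ' → lIdx θ = lIdx θ' → θ = θ' := by
  decide

/-! ## Goodness of the nine-type kernels -/

/-- **Nine-type kernels are good.**  If `S ⊆ {1,…,9}` does not contain both a type in `{5,7}` and a type in `{8,9}`,
then `kerS S` is a good kernel: for every monotone equivalence-valued profile map on the subsets of a finite type the
goods (`P T ∈ AC`, `P Tᶜ = ⊥`) are at least as many as the bad points of types in `S`.  [this work; the combinatorial
content is `NineType.allH_card_le`, prim-bnk-1 gen 17] -/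
theorem goodKernel_kerS (S : Finset ℕ) (hS : ∀ θ ∈ S, 1 ≤ θ ∧ θ ≤ 9)
    (hclash : ¬ ((5 ∈ S ∨ 7 ∈ S) ∧ (8 ∈ S ∨ 9 ∈ S))) : GoodKernel (kerS S) := by
  classical
  refine ⟨fun γ _ _ P hmono heqv => ?_⟩
  -- index function: P T = pp (ι T)
  have hex : ∀ T : Finset γ, ∃ i : Fin 15, P T = pp i := fun T => exists_pat_of_isEqv (heqv T)
  choose ι hι using hex
  have hle : ∀ {A B : Finset γ}, A ⊆ B → ple (ι A) (ι B) = true := by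
    intro A B hAB
    apply ple_of_profLE
    rw [← hι A, ← hι B]
    exact hmono A B hAB
  have hS9 : ∀ θ ∈ S, θ ∈ (Finset.Icc 1 9 : Finset ℕ) := fun θ hθ => Finset.mem_Icc.2 (hS θ hθ)
  -- bad points and goods
  set 𝒯 : Finset (Finset γ) := Finset.univ.filter (fun T => badS S (ι T) (ι Tᶜ)) with h𝒯
  set 𝔊 : Finset (Finset γ) := Finset.univ.filter (fun T => isAC (ι T) ∧ ι Tᶜ = 0) with h𝔊
  -- the type of a bad point
  have htyp : ∀ T ∈ 𝒯, ∃ θ ∈ S, hIdx θ = ι T ∧ lIdx θ = ι Tᶜ := by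
    intro T hT; rw [h𝒯, Finset.mem_filter] at hT; exact hT.2
  choose! θf hθS hθh hθl using htyp
  -- hypotheses of the abstract theorem
  have hθ : ∀ t ∈ 𝒯, 1 ≤ θf t ∧ θf t ≤ 9 := fun t ht => hS _ (hθS t ht)
  have hcl : ¬ ((∃ t ∈ 𝒯, θf t = 5 ∨ θf t = 7) ∧ (∃ t ∈ 𝒯, θf t = 8 ∨ θf t = 9)) := by
    rintro ⟨⟨t, ht, h57⟩, ⟨t', ht', h89⟩⟩
    apply hclash
    refine ⟨?_, ?_⟩
    · rcases h57 with h | h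
      · exact Or.inl (h ▸ hθS t ht)
      · exact Or.inr (h ▸ hθS t ht)
    · rcases h89 with h | h
      · exact Or.inl (h ▸ hθS t' ht')
      · exact Or.inr (h ▸ hθS t' ht')
  have hcont : ∀ s ∈ 𝒯, ∀ t ∈ 𝒯, s ⊆ t → (θf s, θf t) ∈ NineType.contPairs := by
    intro s hs t ht hst
    apply cont_table _ (hS9 _ (hθS s hs)) _ (hS9 _ (hθS t ht))
    · rw [hθh s hs, hθh t ht]; exact hle hst
    · rw [hθl s hs, hθl t ht]; exact hle (Finset.compl_subset_compl.2 hst)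
  have hG : IsUpperSet (𝔊 : Set (Finset γ)) := by
    intro A B hAB hA
    rw [Finset.mem_coe, h𝔊, Finset.mem_filter] at hA ⊢
    refine ⟨Finset.mem_univ _, ac_up_bot_down.1 _ _ hA.2.1 (hle hAB), ac_up_bot_down.2 _ ?_⟩
    rw [← hA.2.2]
    exact hle (Finset.compl_subset_compl.2 hAB)
  have hHL : ∀ t ∈ 𝒯, ∀ t' ∈ 𝒯, NineType.hlOK (θf t) (θf t') = true → t ∪ t'ᶜ ∈ 𝔊 := by
    intro t ht t' ht' hok
    rw [h𝔊, Finset.mem_filter]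
    refine ⟨Finset.mem_univ _, ?_, ?_⟩
    · apply hl_table_join _ (hS9 _ (hθS t ht)) _ (hS9 _ (hθS t' ht')) hok
      · rw [hθh t ht]; exact hle Finset.subset_union_left
      · rw [hθl t' ht']; exact hle Finset.subset_union_right
    · apply hl_table_meet _ (hS9 _ (hθS t ht)) _ (hS9 _ (hθS t' ht')) hok
      · rw [hθl t ht]; apply hle
        intro e he
        rw [Finset.mem_compl, Finset.mem_union, not_or] at he
        exact Finset.mem_compl.2 he.1
      · rw [hθh t' ht']; apply hle
        intro e he
        rw [Finset.mem_compl, Finset.mem_union, not_or, Finset.mem_compl, not_not] at he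
        exact he.2
  have hcard : #𝒯 ≤ #𝔊 := NineType.allH_card_le 𝒯 θf hθ hcl hcont 𝔊 hG hHL
  -- the antipodal count is `#𝔊 − #𝒯`
  have hsum : (∑ T : Finset γ, liftK (kerS S) (P T) (P Tᶜ)) = (#𝔊 : ℤ) - (#𝒯 : ℤ) := by
    have h1 : ∀ T : Finset γ, liftK (kerS S) (P T) (P Tᶜ) =
        (if isAC (ι T) ∧ ι Tᶜ = 0 then (1 : ℤ) else 0) - (if badS S (ι T) (ι Tᶜ) then (1 : ℤ) else 0) := by
      intro T; rw [hι T, hι Tᶜ, liftK_pp]; rfl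
    simp_rw [h1]
    rw [Finset.sum_sub_distrib]
    rw [Finset.sum_boole, Finset.sum_boole]
  have : (#𝒯 : ℤ) ≤ (#𝔊 : ℤ) := by exact_mod_cast hcard
  rw [hsum]; linarith

end TwoCopyMono

end Summit.CriticalPhenomena.PercolationContinuityZ3.Theorems
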